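import Summits.QuantumAdvantage.AdviceFreeQNC0.LeaderElection
import HarnessLib

/-!
# Cell qa-qnc0 (rung F-Q1, route `RingFrame`, crux α `RingToElim`): PROPOSITION S — symmetrization,
# `SymmetrizationLemma` and `ERHIffRingHard` (qn-p2 ROUND-7 §2.2–2.4, ask R7-b)

The Sketch7 §1b statements `SymmetrizationLemma` and `ERHIffRingHard` are copied VERBATIM and PROVED.
* `symmetrizationLemma` (`C = 4`, `n₀ = 64` for EVERY `D`; strong form `Symmetrization.symmetrization`):
  if every rotation-EQUIVARIANT ring strategy `z_b = [p(rot_b x) = 1]` of degree `≤ D + (log₂ n)^4`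
  solves `Rel(C_n)` on `≤ θ·2ⁿ` patterns, every tuple `P` of degree-`D` polynomials solves it on
  `≤ (θ + 1/n)·2ⁿ` patterns.  PROOF: with the leader-election polynomial `e` (`LeaderElection.lean`)
  and an origin shift `s`, the single polynomial `symPoly e P s = Σ_i P_i ∘ rot_{off(i)+s} · e ∘ rot_{off(i)}`
  (`off(i) ≡ −(i+s) (mod n)`, degree `≤ D + (log₂ n)^4`, `symPoly_mem`) has, at a pattern with a unique
  leader `b₀`, the equivariant strategy "`P` run on `rot_{b₀+s} x`, rotated back" (`symPoly_rot`,
  `rel_eqvStrategy_symPoly_iff`, via `rel_rot`); summing the hypothesis over the `n` shifts and double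
  counting (`Σ_s #{x ∈ G : rot_{b₀(x)+s} x ∈ S} = Σ_{s'} #{x ∈ G : rot_{s'} x ∈ S} ≥ n(#S − #Bad)`)
  gives `#S ≤ θ·2ⁿ + #Bad ≤ (θ + 1/n)·2ⁿ`.
* `erhIffRingHard : EquivariantRingHard ↔ RingHard 2` (with `erhOfRingHard` of `RingSymmetry.lean`):
  the SINGLE-POLYNOMIAL form of the crux α is EQUIVALENT to α — normal form N-EQ (WLOG the ring
  adversary is rotation-equivariant; cost `+(log₂ n)^4` degree, `θ ↦ (1+θ)/2`).
* `leaderElect_sq`: leader election already at degree `40(log₂ n)²` — with `leaderElectDegreeLB` the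
  planner's degree bracket `[log₂ n − 1, O(log² n)]` is in the kernel.

Label: instrument / normal form ("a FORM of α, not a rung below it").  WHAT THIS IS NOT: nothing on
α's truth; separation NOT moved.
-/

noncomputable section

open scoped Classical

namespace Summit.QuantumAdvantage.AdviceFreeQNC0

open Finset
open Literature.Computability.QuantumComplexity Literature.Computability.QuantumComplexity.RingHLF
open Literature.Computability.MetaComplexity Literature.Computability.MetaComplexity.Smolensky

/-! ## Sketch7 §1b statements (verbatim, planner qa-qnc0-p2) -/

/-- **PROPOSITION S (PROVABLE, M, from `LowDegLeaderElection`)**: an equivariant strategy of degree `D + (log₂ n)^C` emulates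
every degree-`D` strategy up to `o(2ⁿ)` inputs (run it in coordinates relative to the elected leader, average over the `n`
shifts of the origin); hence ERH is EQUIVALENT to the crux conclusion `RingHard 2`, not weaker. (Sketch7, verbatim.) -/
def SymmetrizationLemma : Prop :=
  ∃ C : ℕ, ∀ D : ℕ, ∃ n₀ : ℕ, ∀ n ≥ n₀, ∀ θ : ℝ, EqvRingHardAt n (D + (Nat.log 2 n) ^ C) θ →
    ∀ P : Fin n → CubeFn (ZMod 2) n, (∀ i, P i ∈ lowDeg (ZMod 2) n D) →
      ((univ.filter fun x : Fin n → Bool => Rel x (fun i => decide (P i x = 1))).card : ℝ) ≤ (θ + 1 / n) * (2 : ℝ) ^ n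

/-- corollary (PROVABLE from `SymmetrizationLemma` + `ERHOfRingHard`): the single-polynomial form of α.
(Sketch7, verbatim.) -/
def ERHIffRingHard : Prop := EquivariantRingHard ↔ RingHard 2
namespace LeaderElection

open RingSymmetry

/-- **Leader election at degree `40·(log₂ n)²`** (`leaderElect` read with its true degree
`t(ℓ+1) = (2L+3)(3L+5) ≤ 40L²`): the upper end of the bracket `[log₂ n − 1, O(log² n)]` (ROUND-7 §2.2). -/
theorem leaderElect_sq (n : ℕ) (hn64 : 64 ≤ n) : LeaderElect n (40 * (Nat.log 2 n) ^ 2) (1 / n) := by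
  have hn : 0 < n := by omega
  set L := Nat.log 2 n with hL
  have hL6 : 6 ≤ L := Nat.le_log_of_pow_le (by norm_num) (by simpa using hn64)
  have hnL : n < 2 ^ (L + 1) := Nat.lt_pow_succ_log_self (by norm_num) n
  set t := 2 * L + 3 with ht
  set ℓ := 3 * L + 4 with hl
  have h2l : 2 * ℓ ≤ n := by
    have := six_mul_add_eight_le_two_pow hL6
    have hLn : 2 ^ L ≤ n := Nat.pow_log_le_self 2 (by omega)
    omega
  have htb : 2 * n ^ 2 ≤ 2 ^ t := by
    have h1 : n ^ 2 < (2 ^ (L + 1)) ^ 2 := Nat.pow_lt_pow_left hnL (by norm_num)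
    have e : 2 ^ t = 2 * (2 ^ (L + 1)) ^ 2 := by rw [ht]; ring
    rw [e]; omega
  have hlb : 2 * n ^ 3 ≤ 2 ^ ℓ := by
    have h1 : n ^ 3 < (2 ^ (L + 1)) ^ 3 := Nat.pow_lt_pow_left hnL (by norm_num)
    have e : 2 ^ ℓ = 2 * (2 ^ (L + 1)) ^ 3 := by rw [hl]; ring
    rw [e]; omega
  obtain ⟨ω, hω⟩ := exists_good_seed hn ℓ t
  have hdeg : t * (ℓ + 1) ≤ 40 * L ^ 2 := by
    rw [ht, hl]; nlinarith
  refine ⟨elect hn ℓ t ω, lowDeg_mono hdeg (elect_mem hn ℓ t ω), ?_⟩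
  have hbad := card_bad_mul_le hn h2l htb hlb hω
  have hnR : (0 : ℝ) < n := by exact_mod_cast hn
  have hbadR : ((univ.filter fun x : Fin n → Bool => fireCount (elect hn ℓ t ω) x ≠ 1).card : ℝ) *
      n ≤ (2 : ℝ) ^ n := by exact_mod_cast hbad
  rw [one_div, inv_mul_eq_div, le_div_iff₀ hnR]
  exact hbadR

end LeaderElection

/-! ## Symmetrization (PROPOSITION S): equivariance is free at polylog degree -/

namespace Symmetrization

open RingSymmetry LeaderElection

variable {n : ℕ}

/-! ### The leader of a pattern -/

/-- the LEADER of `x` under the election polynomial `e`: a rotation at which `e` fires (junk `⟨0,_⟩`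
if none). -/
def leader (hn : 0 < n) (e : CubeFn (ZMod 2) n) (x : Fin n → Bool) : Fin n :=
  if h : ∃ b : Fin n, e (rot b.val x) = 1 then Classical.choose h else ⟨0, hn⟩

/-- If `e` fires at exactly one rotation of `x`, it fires exactly at the leader. -/
theorem fires_iff_eq_leader (hn : 0 < n) {e : CubeFn (ZMod 2) n} {x : Fin n → Bool}
    (hx : fireCount e x = 1) (b : Fin n) : e (rot b.val x) = 1 ↔ b = leader hn e x := by
  unfold fireCount at hx
  obtain ⟨a, ha⟩ := card_eq_one.1 hx
  have hmem : ∀ b : Fin n, e (rot b.val x) = 1 ↔ b = a := by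
    intro b'
    have := Finset.ext_iff.1 ha b'
    rw [mem_filter, mem_singleton] at this
    simpa using this
  have hex : ∃ b : Fin n, e (rot b.val x) = 1 := ⟨a, (hmem a).2 rfl⟩
  have hlead : leader hn e x = a := by
    unfold leader
    rw [dif_pos hex]
    exact (hmem _).1 (Classical.choose_spec hex)
  rw [hlead]
  exact hmem b

/-! ### The symmetrized polynomial -/

/-- the aligning rotation amount `off i s ≡ −(i + s) (mod n)`. -/
def off (n i s : ℕ) : ℕ := n - (i + s) % n

/-- `off i s + (i + s) ≡ 0 (mod n)`. -/
theorem off_add_mod (hn : 0 < n) (i s : ℕ) : (off n i s + (i + s)) % n = 0 := by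
  unfold off
  have hr : (i + s) % n < n := Nat.mod_lt _ hn
  have hqr := Nat.div_add_mod (i + s) n
  have e : n - (i + s) % n + (i + s) = n * ((i + s) / n + 1) := by
    rw [Nat.mul_add, Nat.mul_one]; omega
  rw [e, Nat.mul_mod_right]

/-- **the symmetrized polynomial** of the tuple `P` with origin shift `s`, relative to the election
polynomial `e`: `y ↦ Σ_i P_i(rot_{off i + s} y) · e(rot_{off i} y)` — "find the leader, run `P` in
leader-relative coordinates shifted by `s`, and report the coordinate that lands at the origin". -/
def symPoly (e : CubeFn (ZMod 2) n) (P : Fin n → CubeFn (ZMod 2) n) (s : ℕ) : CubeFn (ZMod 2) n :=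
  fun y => ∑ i : Fin n, P i (rot (off n i.val s + s) y) * e (rot (off n i.val s) y)

/-- Degree of the symmetrized polynomial: `deg P + deg e`. -/
theorem symPoly_mem {D De : ℕ} {e : CubeFn (ZMod 2) n} (he : e ∈ lowDeg (ZMod 2) n De)
    {P : Fin n → CubeFn (ZMod 2) n} (hP : ∀ i, P i ∈ lowDeg (ZMod 2) n D) (s : ℕ) :
    symPoly e P s ∈ lowDeg (ZMod 2) n (D + De) := by
  have e1 : symPoly e P s = ∑ i : Fin n,
      ((fun y => P i (rot (off n i.val s + s) y)) * fun y => e (rot (off n i.val s) y)) := by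
    funext y
    unfold symPoly
    rw [Finset.sum_apply]
    rfl
  rw [e1]
  refine Submodule.sum_mem _ fun i _ => mul_mem_lowDeg_add ?_ ?_
  · exact comp_mem_lowDeg_of_coord (rot (off n i.val s + s)) (ind_rot_mem _) (hP i)
  · exact comp_mem_lowDeg_of_coord (rot (off n i.val s)) (ind_rot_mem _) he

/-- The firing index: at `y = rot b x` with leader `b₀`, the `i`-th term of `symPoly` fires iff
`shift (b₀ + s) i = b`. -/
theorem fire_index_iff (hn : 0 < n) (b₀ b i : Fin n) (s : ℕ) :
    (off n i.val s + b.val) % n = b₀.val ↔ shift n (b₀.val + s) i = b := by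
  have hoff : (off n i.val s + (i.val + s)) % n = 0 % n := by rw [off_add_mod hn, Nat.zero_mod]
  have hb : b.val % n = b.val := Nat.mod_eq_of_lt b.isLt
  have hb₀ : b₀.val % n = b₀.val := Nat.mod_eq_of_lt b₀.isLt
  constructor
  · intro h
    apply Fin.ext
    simp only [shift]
    -- `i + b₀ + s ≡ i + s + off + b ≡ b`
    have h1 : (off n i.val s + b.val) % n = b₀.val % n := by rw [h, hb₀]
    have h2 : (off n i.val s + b.val + (i.val + s)) % n = (b₀.val + (i.val + s)) % n :=
      Nat.ModEq.add_right _ h1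
    have h3 : (off n i.val s + (i.val + s) + b.val) % n = (0 + b.val) % n :=
      Nat.ModEq.add_right _ hoff
    rw [show off n i.val s + b.val + (i.val + s) = off n i.val s + (i.val + s) + b.val by ring, h3,
      Nat.zero_add, hb] at h2
    rw [show i.val + (b₀.val + s) = b₀.val + (i.val + s) by ring, ← h2]
  · intro h
    have hv := congrArg Fin.val h
    simp only [shift] at hv
    -- `off + b ≡ off + i + b₀ + s ≡ b₀`
    have h2 : (off n i.val s + (i.val + (b₀.val + s))) % n = (off n i.val s + b.val) % n :=
      Nat.ModEq.add_left _ (show (i.val + (b₀.val + s)) % n = b.val % n by rw [hv, hb])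
    have h3 : (off n i.val s + (i.val + s) + b₀.val) % n = (0 + b₀.val) % n :=
      Nat.ModEq.add_right _ hoff
    rw [show off n i.val s + (i.val + (b₀.val + s)) = off n i.val s + (i.val + s) + b₀.val by ring,
      h3, Nat.zero_add, hb₀] at h2
    exact h2.symm

/-- the preimage of `b` under `shift (b₀ + s)`. -/
def pre (b₀ : Fin n) (s : ℕ) (b : Fin n) : Fin n :=
  Classical.choose ((shift_bijective (n := n) (b₀.val + s)).2 b)

/-- `shift (b₀ + s) (pre b₀ s b) = b`. -/
theorem shift_pre (b₀ : Fin n) (s : ℕ) (b : Fin n) : shift n (b₀.val + s) (pre b₀ s b) = b :=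
  Classical.choose_spec ((shift_bijective (n := n) (b₀.val + s)).2 b)

/-- `pre b₀ s (shift (b₀ + s) i) = i`. -/
theorem pre_shift (b₀ : Fin n) (s : ℕ) (i : Fin n) : pre b₀ s (shift n (b₀.val + s) i) = i :=
  shift_injective _ (shift_pre b₀ s _)

/-- **Evaluation of the symmetrized polynomial** at a rotation of a pattern with a unique leader
`b₀`: only the term `i = pre b₀ s b` fires, and it reads `P_i` at `rot (b₀ + s) x`. -/
theorem symPoly_rot (hn : 0 < n) {e : CubeFn (ZMod 2) n} {x : Fin n → Bool}
    (hx : fireCount e x = 1) (P : Fin n → CubeFn (ZMod 2) n) (s : ℕ) (b : Fin n) :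
    symPoly e P s (rot b.val x) =
      P (pre (leader hn e x) s b) (rot (((leader hn e x).val) + s) x) := by
  set b₀ := leader hn e x with hb₀
  unfold symPoly
  simp only [rot_rot]
  have h01 : ∀ a : ZMod 2, a ≠ 1 → a = 0 := by decide
  -- which terms fire
  have hfire : ∀ i : Fin n, e (rot (off n i.val s + b.val) x) = 1 ↔ i = pre b₀ s b := by
    intro i
    rw [← rot_mod, fires_iff_eq_leader hn hx ⟨(off n i.val s + b.val) % n, Nat.mod_lt _ hn⟩,
      ← hb₀]
    constructor
    · intro h
      have hv : (off n i.val s + b.val) % n = b₀.val := congrArg Fin.val h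
      have := (fire_index_iff hn b₀ b i s).1 hv
      rw [← this, pre_shift]
    · intro h
      apply Fin.ext
      simp only
      rw [fire_index_iff hn b₀ b i s, h, shift_pre]
  rw [Finset.sum_eq_single (pre b₀ s b)]
  · have h1 : e (rot (off n (pre b₀ s b).val s + b.val) x) = 1 := (hfire _).2 rfl
    rw [h1, mul_one]
    congr 1
    apply rot_eq_rot_of_mod_eq
    have h2 : (off n (pre b₀ s b).val s + b.val) % n = b₀.val :=
      (fire_index_iff hn b₀ b _ s).2 (shift_pre b₀ s b)
    have h3 : (off n (pre b₀ s b).val s + b.val + s) % n = (b₀.val + s) % n :=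
      Nat.ModEq.add_right _ (show (off n (pre b₀ s b).val s + b.val) % n = b₀.val % n by
        rw [h2, Nat.mod_eq_of_lt b₀.isLt])
    rw [← h3]
    congr 1
    ring
  · intro i _ hi
    rw [h01 _ (fun h => hi ((hfire i).1 h)), mul_zero]
  · intro h; exact absurd (mem_univ _) h

/-- **The symmetrized strategy in leader-relative coordinates**: for a pattern with a unique
leader, the equivariant strategy of `symPoly e P s` solves `x` iff `P` solves `rot (b₀ + s) x`. -/
theorem rel_eqvStrategy_symPoly_iff (hn : 0 < n) {e : CubeFn (ZMod 2) n} {x : Fin n → Bool}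
    (hx : fireCount e x = 1) (P : Fin n → CubeFn (ZMod 2) n) (s : ℕ) :
    RingHLF.Rel x (eqvStrategy (symPoly e P s) x) ↔
      RingHLF.Rel (rot ((leader hn e x).val + s) x)
        (fun i => decide (P i (rot ((leader hn e x).val + s) x) = 1)) := by
  set k := (leader hn e x).val + s with hk
  rw [← rel_rot k x]
  have e1 : rot k (eqvStrategy (symPoly e P s) x) =
      fun i => decide (P i (rot k x) = 1) := by
    funext i
    rw [rot_apply]
    unfold eqvStrategy
    rw [symPoly_rot hn hx P s, hk, pre_shift]
  rw [e1]

/-! ### Counting: averaging over the origin shift -/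

/-- **PROPOSITION S, quantitative form (n₀ = 64 independent of `D`)**: if every equivariant strategy of
degree `≤ D + (log₂ n)^4` solves at most `θ·2ⁿ` patterns, then every degree-`D` strategy solves at
most `(θ + 1/n)·2ⁿ` patterns. -/
theorem symmetrization (n : ℕ) (hn64 : 64 ≤ n) (D : ℕ) (θ : ℝ)
    (hE : EqvRingHardAt n (D + (Nat.log 2 n) ^ 4) θ) (P : Fin n → CubeFn (ZMod 2) n)
    (hP : ∀ i, P i ∈ lowDeg (ZMod 2) n D) :
    ((univ.filter fun x : Fin n → Bool => RingHLF.Rel x (fun i => decide (P i x = 1))).card : ℝ) ≤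
      (θ + 1 / n) * (2 : ℝ) ^ n := by
  have hn : 0 < n := by omega
  obtain ⟨e, he, hbad⟩ := leaderElect n hn64
  set S := univ.filter fun x : Fin n → Bool => RingHLF.Rel x (fun i => decide (P i x = 1)) with hS
  set G := univ.filter fun x : Fin n → Bool => fireCount e x = 1 with hG
  set Bad := univ.filter fun x : Fin n → Bool => fireCount e x ≠ 1 with hBad
  have hZ : ∀ s : Fin n,
      ((univ.filter fun x : Fin n → Bool =>
          RingHLF.Rel x (eqvStrategy (symPoly e P s.val) x)).card : ℝ) ≤ θ * (2 : ℝ) ^ n :=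
    fun s => hE _ (symPoly_mem he hP s.val)
  -- on `G`, solving by the symmetrized strategy = `P` solving the rotated pattern
  have hGZ : ∀ s : Fin n,
      (G.filter fun x => rot ((leader hn e x).val + s.val) x ∈ S) ⊆
        univ.filter fun x : Fin n → Bool => RingHLF.Rel x (eqvStrategy (symPoly e P s.val) x) := by
    intro s x hx
    rw [mem_filter, hG, mem_filter] at hx
    rw [mem_filter]
    refine ⟨mem_univ _, ?_⟩
    rw [rel_eqvStrategy_symPoly_iff hn hx.1.2 P s.val]
    have := hx.2
    rw [hS, mem_filter] at this
    exact this.2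
  -- double counting: `Σ_s #(G ∩ {rot (b₀+s) x ∈ S}) = Σ_{s'} #(G ∩ {rot s' x ∈ S})`
  have hswap : ∑ s : Fin n, (G.filter fun x => rot ((leader hn e x).val + s.val) x ∈ S).card =
      ∑ s' : Fin n, (G.filter fun x => rot s'.val x ∈ S).card := by
    simp only [card_filter]
    rw [Finset.sum_comm]
    conv_rhs => rw [Finset.sum_comm]
    refine sum_congr rfl fun x _ => ?_
    simp only [← card_filter]
    have e2 : (univ.filter fun s : Fin n => rot ((leader hn e x).val + s.val) x ∈ S) =
        univ.filter fun s : Fin n => rot (shift n (leader hn e x).val s).val x ∈ S := by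
      refine filter_congr fun s _ => ?_
      rw [show (leader hn e x).val + s.val = s.val + (leader hn e x).val by ring]
      simp only [shift, rot_mod]
    rw [e2]
    exact card_filter_shift (leader hn e x).val (fun s' : Fin n => rot s'.val x ∈ S)
  -- `#{x : rot s' x ∈ S} = #S ≤ #(G ∩ {rot s' x ∈ S}) + #Bad`
  have hsplit : ∀ s' : Fin n, S.card ≤ (G.filter fun x => rot s'.val x ∈ S).card + Bad.card := by
    intro s'
    have hS' : (univ.filter fun x : Fin n → Bool => rot s'.val x ∈ S).card = S.card := by
      rw [card_filter_rot s'.val (fun y : Fin n → Bool => y ∈ S), filter_mem_eq_inter, univ_inter]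
    rw [← hS']
    calc (univ.filter fun x : Fin n → Bool => rot s'.val x ∈ S).card
        ≤ ((G.filter fun x => rot s'.val x ∈ S) ∪ Bad).card := by
          refine card_le_card fun x hx => ?_
          rw [mem_filter] at hx
          rw [mem_union]
          by_cases h : fireCount e x = 1
          · exact Or.inl (mem_filter.2 ⟨by rw [hG]; exact mem_filter.2 ⟨mem_univ _, h⟩, hx.2⟩)
          · exact Or.inr (by rw [hBad]; exact mem_filter.2 ⟨mem_univ _, h⟩)
      _ ≤ _ := card_union_le _ _
  have hsum : (n : ℝ) * S.card ≤ n * (θ * (2 : ℝ) ^ n) + n * Bad.card := by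
    have h1 : n * S.card ≤ ∑ s' : Fin n, ((G.filter fun x => rot s'.val x ∈ S).card + Bad.card) := by
      calc n * S.card = ∑ _s' : Fin n, S.card := by rw [sum_const, card_univ, Fintype.card_fin, smul_eq_mul]
        _ ≤ _ := sum_le_sum fun s' _ => hsplit s'
    rw [sum_add_distrib, sum_const, card_univ, Fintype.card_fin, smul_eq_mul, ← hswap] at h1
    have h2 : ∑ s : Fin n, ((G.filter fun x => rot ((leader hn e x).val + s.val) x ∈ S).card : ℝ)
        ≤ n * (θ * (2 : ℝ) ^ n) := by
      calc ∑ s : Fin n, ((G.filter fun x => rot ((leader hn e x).val + s.val) x ∈ S).card : ℝ)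
          ≤ ∑ _s : Fin n, θ * (2 : ℝ) ^ n :=
            sum_le_sum fun s _ => le_trans (by exact_mod_cast card_le_card (hGZ s)) (hZ s)
        _ = n * (θ * (2 : ℝ) ^ n) := by rw [sum_const, card_univ, Fintype.card_fin, nsmul_eq_mul]
    have h1R : ((n * S.card : ℕ) : ℝ) ≤
        ((∑ s : Fin n, (G.filter fun x => rot ((leader hn e x).val + s.val) x ∈ S).card : ℕ) : ℝ) +
          ((n * Bad.card : ℕ) : ℝ) := by exact_mod_cast h1
    push_cast at h1R
    linarith
  have hnR : (0 : ℝ) < n := by exact_mod_cast hn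
  have hBadR : (Bad.card : ℝ) ≤ 1 / n * (2 : ℝ) ^ n := hbad
  have : (S.card : ℝ) ≤ θ * (2 : ℝ) ^ n + Bad.card := by
    have := hsum
    nlinarith
  calc (S.card : ℝ) ≤ θ * (2 : ℝ) ^ n + Bad.card := this
    _ ≤ θ * (2 : ℝ) ^ n + 1 / n * (2 : ℝ) ^ n := by linarith
    _ = (θ + 1 / n) * (2 : ℝ) ^ n := by ring

end Symmetrization

/-- **`SymmetrizationLemma` — PROVED** (PROPOSITION S of qn-p2 ROUND-7 §2.4; `C = 4`, `n₀ = 64` for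
every `D`). -/
theorem symmetrizationLemma : SymmetrizationLemma :=
  ⟨4, fun D => ⟨64, fun n hn θ hE P hP => Symmetrization.symmetrization n hn D θ hE P hP⟩⟩

/-- Monotonicity of equivariant hardness in the degree. -/
theorem eqvRingHardAt_mono {n D D' : ℕ} {θ : ℝ} (h : EqvRingHardAt n D' θ) (hD : D ≤ D') :
    EqvRingHardAt n D θ :=
  fun p hp => h p (lowDeg_mono hD hp)

/-- **`ERHIffRingHard` — PROVED**: equivariant ring hardness (ONE polynomial, `z_b = p ∘ rot_b`) is
EQUIVALENT to the crux conclusion `RingHard 2` — the single-polynomial normal form N-EQ of α. -/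
theorem erhIffRingHard : ERHIffRingHard := by
  refine ⟨fun h => ?_, erhOfRingHard⟩
  obtain ⟨θ, hθ, hall⟩ := h
  refine ⟨(θ + 1) / 2, by linarith, fun c => ?_⟩
  obtain ⟨n₁, hn₁⟩ := hall (max c 4 + 1)
  have h1θ : (0 : ℝ) < 1 - θ := by linarith
  refine ⟨max (max n₁ 64) (Nat.ceil (2 / (1 - θ))), fun n hn P hP => ?_⟩
  have hn₁' : n₁ ≤ n := le_trans (le_trans (le_max_left _ _) (le_max_left _ _)) hn
  have hn64 : 64 ≤ n := le_trans (le_trans (le_max_right _ _) (le_max_left _ _)) hn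
  have hceil : (Nat.ceil (2 / (1 - θ)) : ℝ) ≤ n := by
    exact_mod_cast le_trans (le_max_right _ _) hn
  have hnR : (2 / (1 - θ) : ℝ) ≤ n := le_trans (Nat.le_ceil _) hceil
  have hnpos : (0 : ℝ) < n := by exact_mod_cast (show 0 < n by omega)
  set L := Nat.log 2 n with hL
  have hL2 : 2 ≤ L := Nat.le_log_of_pow_le (by norm_num) (show 2 ^ 2 ≤ n by omega)
  have hdeg : L ^ c + L ^ 4 ≤ L ^ (max c 4 + 1) := by
    have h1 : L ^ c ≤ L ^ max c 4 := Nat.pow_le_pow_right (by omega) (le_max_left _ _)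
    have h2 : L ^ 4 ≤ L ^ max c 4 := Nat.pow_le_pow_right (by omega) (le_max_right _ _)
    calc L ^ c + L ^ 4 ≤ L ^ max c 4 + L ^ max c 4 := Nat.add_le_add h1 h2
      _ = 2 * L ^ max c 4 := by ring
      _ ≤ L * L ^ max c 4 := Nat.mul_le_mul_right _ hL2
      _ = L ^ (max c 4 + 1) := by ring
  have hE : EqvRingHardAt n (L ^ c + L ^ 4) θ := eqvRingHardAt_mono (hn₁ n hn₁') hdeg
  have hmain := Symmetrization.symmetrization n hn64 (L ^ c) θ hE P hP
  have h1n : (1 : ℝ) / n ≤ (1 - θ) / 2 := by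
    rw [div_le_iff₀ hnpos]
    have : (2 : ℝ) ≤ n * (1 - θ) := by
      have := (div_le_iff₀ h1θ).1 hnR
      linarith
    linarith
  have h2n : (0 : ℝ) ≤ (2 : ℝ) ^ n := by positivity
  calc ((univ.filter fun x : Fin n → Bool => RingHLF.Rel x (fun i => decide (P i x = 1))).card : ℝ)
      ≤ (θ + 1 / n) * (2 : ℝ) ^ n := hmain
    _ ≤ ((θ + 1) / 2) * (2 : ℝ) ^ n := by
        apply mul_le_mul_of_nonneg_right _ h2n
        linarith

end Summit.QuantumAdvantage.AdviceFreeQNC0
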